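import Literature.NumberTheory.Rogawski1990.AdelicStableConjugacyG
import Literature.NumberTheory.Automorphic.LocalStableOrbitalFinite
import Literature.NumberTheory.Automorphic.ArchStableOrbitalFinite
import HarnessLib

/-!
# The adelic stable class meets a compact set in finitely many `G(𝐀)`-classes; the stable orbital sum `Σ_{𝒞_𝐀} Φ(δ, f)` of the
# quasi-split `G = U(Φ₃)` is finitely supported for every `f ∈ C_c(G(𝐀))`
(Rogawski, *Automorphic representations of unitary groups in three variables* (1990), §3.3 p. 21, §4.3 p. 44, §5.4 pp. 72–73 (print): «the sum is
finite by the above remark»; Kottwitz 1986 = [Kt₄], Prop. 7.1 ∕ §7.3)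

Topic `NumberTheory/Rogawski1990` (§2–§3) on a generic §1 in `Literature.NumberTheory.Automorphic.UnitaryGroup`; THEOREMS ONLY (no definition, no instance,
no named fact, no `sorry`).  Consumes ★ `AdelicStableConjugacyG` (`MatchingAdeleG`, `MatchingAdeleG.classes`, the named fact `MatchingAdeleGEventuallyKConj`
= [Kt₄] Prop. 7.1 in print's `K_v`-form, `eventually_toLocal_mem_cmLocalIntegralLevel`), ★ `LocalStableOrbitalFinite` ∕ ★ `ArchStableOrbitalFinite`
(finitely many local ∕ archimedean classes of a regular stable class meet a compact set), ★ `UnitaryGroupAdelicProduct` ∕ ★ `UnitaryGroupRestrictedProduct`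
∕ ★ `UnitaryGroupPureTensorContinuity` (the restricted-product structure of `U(J)(𝔸)`).

* §1 (generic `U(J)(𝔸_F)`, any CM-type datum `(F, E, c, N, J)`, namespace `…Automorphic.UnitaryGroup`): `eq_of_archPart_eq_of_forall_toLocal_eq` — an adelic
  point is determined by its archimedean part and all its local components; `exists_adelic_of_eventually_mem` — local components `y_v ∈ U(J)(F_v)`,
  integral for almost all `v`, and an archimedean component GLUE to an adelic point; **`isConj_of_isConj_archPart_of_forall_exists_conj`** — THE GLUING
  LEMMA: two adelic points conjugate at `∞`, conjugate at every finite place, and conjugate BY AN INTEGRAL ELEMENT at almost every finite place, are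
  `U(J)(𝔸_F)`-conjugate; `exists_finset_forall_toLocal_mem_of_isCompact` — a compact subset of `U(J)(𝔸_F)` is integral off ONE finite set of places;
  `IsRegularElt.map` — regularity is preserved by base change.
* §2 (`G = U(Φ₃)` over a CM field, regular `γ₀ ∈ U(H)(L⁺)` with a rational correspondent `γ`): **`MatchingAdeleG.finite_setOf_mem_classes_inter_of_eventually`**
  — given the a.e. `K_v`-conjugacy of [Kt₄] Prop. 7.1 at `(γ₀, γ)` as a HYPOTHESIS `hP`, only FINITELY many classes of `𝒞_𝐀 = MatchingAdeleG.classes L H γ₀`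
  meet a given compact subset of `G(𝐀)`.
* §3 **`MatchingAdeleG.finite_classes_inter_support_classOrbitalIntegral_of_eventually`** — hence for EVERY family `m` of orbital measures on the adelic
  classes and EVERY `f` with compact support, `(MatchingAdeleG.classes L H γ₀ ∩ Function.support (classOrbitalIntegral m f)).Finite`.
* §4 the NAMED-FACT forms over ★ `MatchingAdeleGEventuallyKConj` (ed. 2 of ★ `AdelicStableConjugacyG`): `MatchingAdeleG.finite_setOf_mem_classes_inter`,
  **`MatchingAdeleG.finite_classes_inter_support_classOrbitalIntegral`** (+ `_cc` for `f ∈ C_c`, + `_of_hermitian` with `γ` supplied by Kottwitz–Steinberg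
  ★ `exists_corresponds_antidiagThree_all`): the `finsum` defining the adelic stable orbital integral `Σ_{δ ∈ 𝒞_𝐀} Φ(δ, f)` (typer brick
  `AdelicStableOrbitalIntegral`, `adelicStableOrbitalIntegralG`) is an honest finite sum — no Euler hypothesis, no normalisation of `m`.

## References
* J. D. Rogawski, *Automorphic Representations of Unitary Groups in Three Variables*, Ann. of Math. Stud. 123 (1990), §3.3 p. 21, §4.3 p. 44, §5.4 pp. 72–73
  [Rogawski1990].
* R. E. Kottwitz, *Stable trace formula: elliptic singular terms*, Math. Ann. 275 (1986), Prop. 7.1, §7.3 [Kottwitz1986].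
* A. Borel, H. Jacquet, *Automorphic forms and automorphic representations*, Proc. Sympos. Pure Math. 33.1 (1979), §4.1 [BorelJacquet1979].
* V. Platonov, A. Rapinchuk, *Algebraic Groups and Number Theory* (1994), §5.1 [PlatonovRapinchuk1994].
-/
noncomputable section

open NumberField IsDedekindDomain Filter Topology
open scoped MatrixGroups RestrictedProduct

namespace Literature.NumberTheory.Automorphic

namespace UnitaryGroup

/-! ## §1 Gluing local conjugators into an adelic one (generic `U(J)(𝔸_F)`) -/

section Gluing

variable (F E : Type) [Field F] [NumberField F] [Field E] [NumberField E] [Algebra F E] (c : E ≃ₐ[F] E) (N : ℕ)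
  (J : Matrix (Fin N) (Fin N) E)

/-- **An adelic point is determined by its archimedean part and its local components**: if `g_∞ = g′_∞` (★ `archPart`) and `g_v = g′_v` for
every finite place `v` (the datum's `toLocal v` = ★ `UnitaryGroup.toLocal`), then `g = g′` — the finite part is the restricted product of the local
components (★ `finAdelicEquiv`, ★ `localPiEquiv_evalPlace_finPart`) and `g = (g_∞, 1)·(1, g_f)` (★ `archToAdelic_mul_finAdelicToAdelic`).
[cite: BorelJacquet1979, §4.1] -/
theorem eq_of_archPart_eq_of_forall_toLocal_eq {g g' : (adelicGroupData F E c N J).Adelic}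
    (ha : archPart F E c N J g = archPart F E c N J g')
    (hv : ∀ v : HeightOneSpectrum (𝓞 F), (adelicGroupData F E c N J).toLocal v g = (adelicGroupData F E c N J).toLocal v g') :
    g = g' := by
  have hfin : finPart F E c N J g = finPart F E c N J g' := by
    apply (finAdelicEquiv F E c N J).injective
    refine RestrictedProduct.ext _ _ fun v => ?_
    apply (localPiEquiv E c N J v).injective
    show localPiEquiv E c N J v (evalPlace F E c N J v (finPart F E c N J g)) =
      localPiEquiv E c N J v (evalPlace F E c N J v (finPart F E c N J g'))
    rw [localPiEquiv_evalPlace_finPart, localPiEquiv_evalPlace_finPart]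
    exact hv v
  rw [← archToAdelic_mul_finAdelicToAdelic F E c N J g, ← archToAdelic_mul_finAdelicToAdelic F E c N J g', ha, hfin]

/-- **Local components glue**: given `y_v ∈ U(J)(F_v)` for every finite place `v` with `y_v ∈ U(J)(𝒪_v)` for almost all `v` (★ `localIntegralLevel`) and
`a ∈ U(J)(E ⊗ ℝ)`, there is an adelic `x ∈ U(J)(𝔸_F)` with `x_∞ = a` and `x_v = y_v` for all `v` (the restricted product ★ `finAdelicEquiv` and
`x = (a, 1)·(1, x_f)`). [cite: BorelJacquet1979, §4.1] [cite: PlatonovRapinchuk1994, §5.1] -/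
theorem exists_adelic_of_eventually_mem (a : arch F E c N J) (y : ∀ v : HeightOneSpectrum (𝓞 F), (adelicGroupData F E c N J).Local v)
    (hy : ∀ᶠ v in cofinite, y v ∈ localIntegralLevel c N J v) :
    ∃ x : (adelicGroupData F E c N J).Adelic, archPart F E c N J x = a ∧
      ∀ v, (adelicGroupData F E c N J).toLocal v x = y v := by
  have hz : ∀ᶠ v in cofinite, (localPiEquiv E c N J v).symm (y v) ∈ localInt E c N J v := by
    filter_upwards [hy] with v hv
    exact (localPiEquiv_symm_mem_localInt_iff c N J v (y v)).2 hv
  let z : Πʳ v : HeightOneSpectrum (𝓞 F), [localPi E c N J v, localInt E c N J v] :=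
    RestrictedProduct.mk (fun v => (localPiEquiv E c N J v).symm (y v)) hz
  let xf : finAdelic F E c N J := (finAdelicEquiv F E c N J).symm z
  refine ⟨archToAdelic F E c N J a * finAdelicToAdelic F E c N J xf, ?_, fun v => ?_⟩
  · rw [map_mul, archPart_archToAdelic, archPart_finAdelicToAdelic, mul_one]
  · have h1 : evalPlace F E c N J v xf = (localPiEquiv E c N J v).symm (y v) := by
      show (finAdelicEquiv F E c N J ((finAdelicEquiv F E c N J).symm z)) v = _
      rw [ContinuousMulEquiv.apply_symm_apply]
      rfl
    have h2 : (adelicGroupData F E c N J).toLocal v (finAdelicToAdelic F E c N J xf) = y v := by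
      have h3 := localPiEquiv_evalPlace F E c N J v xf
      rw [h1, ContinuousMulEquiv.apply_symm_apply] at h3
      exact (Subtype.ext h3).symm
    have h4 : (adelicGroupData F E c N J).toLocal v (archToAdelic F E c N J a) = 1 := toLocal_archToAdelic F E c N J v a
    rw [map_mul, h4, one_mul, h2]

/-- **THE GLUING LEMMA — local conjugacy everywhere, integral conjugators almost everywhere ⇒ adelic conjugacy**: for `δ, δ′ ∈ U(J)(𝔸_F)`, if
`δ_∞ ∼ δ′_∞` in `U(J)(E ⊗ ℝ)`, `δ_v ∼ δ′_v` in `U(J)(F_v)` for every finite `v`, and for almost every `v` some conjugator can be taken IN `U(J)(𝒪_v)`,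
then `δ ∼ δ′` in `U(J)(𝔸_F)` — choose a conjugator at each place (integral wherever possible), glue them into an adelic element
(`exists_adelic_of_eventually_mem`), and compare both sides place by place (`eq_of_archPart_eq_of_forall_toLocal_eq`).  This is the step «`𝒞_𝐀 ↪ ∏_v 𝒞_v`»
behind print's description of `𝒪_st(γ∕𝐀)` modulo `G(𝐀)`-conjugacy place by place [§3.3 p. 21]. [cite: Rogawski1990, §3.3 p. 21] [cite: BorelJacquet1979, §4.1] -/
theorem isConj_of_isConj_archPart_of_forall_exists_conj {δ δ' : (adelicGroupData F E c N J).Adelic}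
    (ha : IsConj (archPart F E c N J δ) (archPart F E c N J δ'))
    (hv : ∀ v : HeightOneSpectrum (𝓞 F), IsConj ((adelicGroupData F E c N J).toLocal v δ) ((adelicGroupData F E c N J).toLocal v δ'))
    (hK : ∀ᶠ v in cofinite, ∃ k : (adelicGroupData F E c N J).Local v, k ∈ localIntegralLevel c N J v ∧
      k * (adelicGroupData F E c N J).toLocal v δ * k⁻¹ = (adelicGroupData F E c N J).toLocal v δ') :
    IsConj δ δ' := by
  classical
  obtain ⟨a, haeq⟩ := isConj_iff.1 ha
  -- at each finite place choose a conjugator, integral where `hK` provides one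
  have hchoice : ∀ v : HeightOneSpectrum (𝓞 F), ∃ y : (adelicGroupData F E c N J).Local v,
      y * (adelicGroupData F E c N J).toLocal v δ * y⁻¹ = (adelicGroupData F E c N J).toLocal v δ' ∧
        ((∃ k : (adelicGroupData F E c N J).Local v, k ∈ localIntegralLevel c N J v ∧
          k * (adelicGroupData F E c N J).toLocal v δ * k⁻¹ = (adelicGroupData F E c N J).toLocal v δ') →
          y ∈ localIntegralLevel c N J v) := by
    intro v
    by_cases h : ∃ k : (adelicGroupData F E c N J).Local v, k ∈ localIntegralLevel c N J v ∧
        k * (adelicGroupData F E c N J).toLocal v δ * k⁻¹ = (adelicGroupData F E c N J).toLocal v δ'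
    · obtain ⟨k, hk, hkeq⟩ := h
      exact ⟨k, hkeq, fun _ => hk⟩
    · obtain ⟨y, hyeq⟩ := isConj_iff.1 (hv v)
      exact ⟨y, hyeq, fun h' => absurd h' h⟩
  choose y hyconj hyint using hchoice
  have hy : ∀ᶠ v in cofinite, y v ∈ localIntegralLevel c N J v := by
    filter_upwards [hK] with v hv'
    exact hyint v hv'
  obtain ⟨x, hxa, hxv⟩ := exists_adelic_of_eventually_mem F E c N J a y hy
  refine isConj_iff.2 ⟨x, ?_⟩
  apply eq_of_archPart_eq_of_forall_toLocal_eq F E c N J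
  · rw [map_mul, map_mul, map_inv, hxa, haeq]
  · intro v
    rw [map_mul, map_mul, map_inv, hxv v, hyconj v]

/-- **A compact subset of `U(J)(𝔸_F)` is integral off a finite set of places, UNIFORMLY**: `∃ S` finite with `g_v ∈ U(J)(𝒪_v)` for all `g ∈ C` and
all `v ∉ S` — the open subgroups `K^S` (★ `awayIntegralLevel`, ★ `isOpen_awayIntegralLevel`) form a directed open cover of `U(J)(𝔸_F)` (every adelic
point is integral a.e., ★ `eventually_evalPlace_mem_localInt` ∕ ★ `toLocal_mem_localIntegralLevel_iff`), so one of them contains the compact `C`.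
[cite: BorelJacquet1979, §4.1] -/
theorem exists_finset_forall_toLocal_mem_of_isCompact {C : Set (adelicGroupData F E c N J).Adelic} (hC : IsCompact C) :
    ∃ S : Finset (HeightOneSpectrum (𝓞 F)), ∀ g ∈ C, ∀ v ∉ S, (adelicGroupData F E c N J).toLocal v g ∈ localIntegralLevel c N J v := by
  classical
  have hcover : C ⊆ ⋃ S : Finset (HeightOneSpectrum (𝓞 F)), (awayIntegralLevel F E c N J S : Set (adelicGroupData F E c N J).Adelic) := by
    intro g _
    have hev : ∀ᶠ v in cofinite, (adelicGroupData F E c N J).toLocal v g ∈ localIntegralLevel c N J v := by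
      filter_upwards [eventually_evalPlace_mem_localInt F E c N J (finPart F E c N J g)] with v hv
      exact (toLocal_mem_localIntegralLevel_iff F E c N J v g).2 hv
    have hfin := Filter.eventually_cofinite.1 hev
    refine Set.mem_iUnion.2 ⟨hfin.toFinset, (mem_awayIntegralLevel_iff F E c N J _ g).2 fun v hv => ?_⟩
    by_contra hnot
    exact hv (hfin.mem_toFinset.2 hnot)
  obtain ⟨t, ht⟩ := hC.elim_finite_subcover _ (fun S => isOpen_awayIntegralLevel F E c N J S) hcover
  refine ⟨t.sup id, fun g hg v hv => ?_⟩
  obtain ⟨S, hSt, hgS⟩ := Set.mem_iUnion₂.1 (ht hg)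
  have hvS : v ∉ S := fun h => hv (Finset.mem_sup.2 ⟨S, hSt, h⟩)
  exact (mem_awayIntegralLevel_iff F E c N J S g).1 hgS v hvS

end Gluing

/-- **Regularity is preserved by base change**: `IsRegularElt g ⇒ IsRegularElt (GL_n(φ) g)` for a ring map `φ` (the characteristic polynomial
commutes with `φ`, Mathlib `Matrix.charpoly_map`, and separability is preserved, `Polynomial.Separable.map`). [cite: Rogawski1990, §3.1 p. 19] -/
theorem _root_.Literature.NumberTheory.Rogawski1990.IsRegularElt.map {R S : Type*} [CommRing R] [CommRing S] {n : Type*} [Fintype n] [DecidableEq n]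
    (φ : R →+* S) {g : GL n R} (hg : Literature.NumberTheory.Rogawski1990.IsRegularElt g) :
    Literature.NumberTheory.Rogawski1990.IsRegularElt (Matrix.GeneralLinearGroup.map φ g) := by
  unfold Literature.NumberTheory.Rogawski1990.IsRegularElt at hg ⊢
  have h : ((Matrix.GeneralLinearGroup.map φ g : GL n S) : Matrix n n S) = (g : Matrix n n R).map φ := rfl
  rw [h, Matrix.charpoly_map]
  exact hg.map

end UnitaryGroup

end Literature.NumberTheory.Automorphic

namespace Literature.NumberTheory.Rogawski1990

open Literature.NumberTheory.Automorphic
open Literature.AlgebraicGeometry.ShimuraVarieties (unitaryGroup)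
open Literature.NumberTheory.QuadraticForms.Landherr (conjTranspose)
open Literature.NumberTheory.GelbartRogawski1991.UnitaryDualPair (complexConj_imagUnit imagUnit_ne_zero)

/-! ## §2 Only finitely many classes of `𝒞_𝐀 = MatchingAdeleG.classes γ₀` meet a compact set -/

section Finite

variable (L : Type) [Field L] [NumberField L] [IsCMField L] (H : Matrix (Fin 3) (Fin 3) L)

variable {L H}

/-- **Only finitely many `G(𝐀)`-classes of the adelic stable class `𝒪_st(γ₀ ∕ 𝐀)` meet a compact set** (`G = U(Φ₃)`, `γ₀ ∈ U(H)(L⁺)` regular with a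
rational correspondent `γ ∈ U(Φ₃)(L⁺)`, under the named fact ★ `MatchingAdeleGEventuallyKConj` = [Kt₄] Prop. 7.1): for `C ⊂ U(Φ₃)(𝔸_L)` compact,
`{c ∈ 𝒞_𝐀 | c ∩ C ≠ ∅}` is finite.  PROOF: `C` is integral off a finite `S` (`exists_finset_forall_toLocal_mem_of_isCompact`); off `S ∪ S_bad(γ₀, γ)`
every component of a matching adèle in `C` is `K_v`-conjugate to `γ_v` (the fact); at the finitely many remaining places and at `∞` only finitely many
local classes of the (regular) local stable class meet the compact image of `C` (★ `finite_image_conjClassesMk_inter_stableClass`: the local classes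
are relatively open in the closed local stable class); and a `G(𝐀)`-class is determined by these local classes (the gluing lemma
`UnitaryGroup.isConj_of_isConj_archPart_of_forall_exists_conj`, integral conjugators off `S ∪ S_bad`).  This is print's «for `f` of compact support the
sum over `𝒞_𝐀` is finite» [§4.3 p. 44; §5.4 p. 72]. [cite: Rogawski1990, §3.3 p. 21; §4.3 p. 44] [cite: Kottwitz1986, Prop. 7.1] -/
theorem MatchingAdeleG.finite_setOf_mem_classes_inter_of_eventually
    {γ₀ : (UnitaryGroup.cmDatum L 3 H).Rational} (hreg : IsRegularElt (γ₀.val : GL (Fin 3) L))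
    {γ : (UnitaryGroup.cmDatum L 3 (Matrix.of fun i j : Fin 3 => if i.val + j.val + 1 = 3 then (1 : L) else 0)).Rational} (hγ : Corresponds (cmConjRingHom L) H (Matrix.of fun i j : Fin 3 => if i.val + j.val + 1 = 3 then (1 : L) else 0) γ₀ γ)
    (hP : ∀ᶠ v in cofinite, ∀ g : (UnitaryGroup.cmDatum L 3 (Matrix.of fun i j : Fin 3 => if i.val + j.val + 1 = 3 then (1 : L) else 0)).Local v,
      g ∈ UnitaryGroup.cmLocalIntegralLevel L 3 (Matrix.of fun i j : Fin 3 => if i.val + j.val + 1 = 3 then (1 : L) else 0) v →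
        Corresponds (UnitaryGroup.conjLocal L (IsCMField.complexConj L) v)
            ((UnitaryGroup.adelicForm L 3 H).map (UnitaryGroup.adeleToLocal L v))
            ((UnitaryGroup.adelicForm L 3 (Matrix.of fun i j : Fin 3 => if i.val + j.val + 1 = 3 then (1 : L) else 0)).map (UnitaryGroup.adeleToLocal L v))
            ((UnitaryGroup.cmDatum L 3 H).toLocal v ((UnitaryGroup.cmDatum L 3 H).toAdelic γ₀)) g →
          ∃ k ∈ UnitaryGroup.cmLocalIntegralLevel L 3 (Matrix.of fun i j : Fin 3 => if i.val + j.val + 1 = 3 then (1 : L) else 0) v,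
            k * (UnitaryGroup.cmDatum L 3 (Matrix.of fun i j : Fin 3 => if i.val + j.val + 1 = 3 then (1 : L) else 0)).toLocal v ((UnitaryGroup.cmDatum L 3 (Matrix.of fun i j : Fin 3 => if i.val + j.val + 1 = 3 then (1 : L) else 0)).toAdelic γ) * k⁻¹ = g)
    {C : Set (UnitaryGroup.cmDatum L 3 (Matrix.of fun i j : Fin 3 => if i.val + j.val + 1 = 3 then (1 : L) else 0)).Adelic} (hC : IsCompact C) :
    {c : ConjClasses (UnitaryGroup.cmDatum L 3 (Matrix.of fun i j : Fin 3 => if i.val + j.val + 1 = 3 then (1 : L) else 0)).Adelic |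
      c ∈ MatchingAdeleG.classes L H γ₀ ∧ ∃ g ∈ C, ConjClasses.mk g = c}.Finite := by
  classical
  -- regularity of `γ` and of its components
  have hγreg : IsRegularElt (γ.val : GL (Fin 3) L) := isRegularElt_of_isConj hγ hreg
  have hγv : ∀ v : HeightOneSpectrum (𝓞 ↥(maximalRealSubfield L)),
      IsRegularElt (((UnitaryGroup.cmDatum L 3 (Matrix.of fun i j : Fin 3 => if i.val + j.val + 1 = 3 then (1 : L) else 0)).toLocal v ((UnitaryGroup.cmDatum L 3 (Matrix.of fun i j : Fin 3 => if i.val + j.val + 1 = 3 then (1 : L) else 0)).toAdelic γ)).val :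
        GL (Fin 3) (UnitaryGroup.LocalRing L v)) := fun v =>
    (hγreg.map (algebraMap L (AdeleRing (𝓞 L) L))).map (UnitaryGroup.adeleToLocal L v)
  have hγi : IsRegularElt ((cmRationalToArch L 3 (Matrix.of fun i j : Fin 3 => if i.val + j.val + 1 = 3 then (1 : L) else 0) γ).val : GL (Fin 3) (mixedEmbedding.mixedSpace L)) := hγreg.map (mixedEmbedding L)
  -- (1) `C` is integral off a finite set `S`
  obtain ⟨S, hS⟩ := UnitaryGroup.exists_finset_forall_toLocal_mem_of_isCompact (↥(maximalRealSubfield L)) L (IsCMField.complexConj L) 3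
    (Matrix.of fun i j : Fin 3 => if i.val + j.val + 1 = 3 then (1 : L) else 0) hC
  -- (2) the bad places of the hypothesis
  have hTfin := Filter.eventually_cofinite.1 hP
  set T : Finset (HeightOneSpectrum (𝓞 ↥(maximalRealSubfield L))) := S ∪ hTfin.toFinset with hTdef
  have hTS : ∀ v ∉ T, v ∉ S := fun v hv h => hv (Finset.mem_union_left _ h)
  have hTP : ∀ v ∉ T, ∀ g : (UnitaryGroup.cmDatum L 3 (Matrix.of fun i j : Fin 3 => if i.val + j.val + 1 = 3 then (1 : L) else 0)).Local v,
      g ∈ UnitaryGroup.cmLocalIntegralLevel L 3 (Matrix.of fun i j : Fin 3 => if i.val + j.val + 1 = 3 then (1 : L) else 0) v →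
        Corresponds (UnitaryGroup.conjLocal L (IsCMField.complexConj L) v)
            ((UnitaryGroup.adelicForm L 3 H).map (UnitaryGroup.adeleToLocal L v))
            ((UnitaryGroup.adelicForm L 3 (Matrix.of fun i j : Fin 3 => if i.val + j.val + 1 = 3 then (1 : L) else 0)).map (UnitaryGroup.adeleToLocal L v))
            ((UnitaryGroup.cmDatum L 3 H).toLocal v ((UnitaryGroup.cmDatum L 3 H).toAdelic γ₀)) g →
          ∃ k ∈ UnitaryGroup.cmLocalIntegralLevel L 3 (Matrix.of fun i j : Fin 3 => if i.val + j.val + 1 = 3 then (1 : L) else 0) v,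
            k * (UnitaryGroup.cmDatum L 3 (Matrix.of fun i j : Fin 3 => if i.val + j.val + 1 = 3 then (1 : L) else 0)).toLocal v ((UnitaryGroup.cmDatum L 3 (Matrix.of fun i j : Fin 3 => if i.val + j.val + 1 = 3 then (1 : L) else 0)).toAdelic γ) * k⁻¹ = g := by
    intro v hv
    by_contra hnot
    exact hv (Finset.mem_union_right _ (hTfin.mem_toFinset.2 hnot))
  -- (3) representatives IN `C` of the classes meeting `C`
  let rep : ConjClasses (UnitaryGroup.cmDatum L 3 (Matrix.of fun i j : Fin 3 => if i.val + j.val + 1 = 3 then (1 : L) else 0)).Adelic → (UnitaryGroup.cmDatum L 3 (Matrix.of fun i j : Fin 3 => if i.val + j.val + 1 = 3 then (1 : L) else 0)).Adelic := fun c =>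
    if h : ∃ g ∈ C, ConjClasses.mk g = c then h.choose else Quotient.out c
  have hrep : ∀ c : ConjClasses (UnitaryGroup.cmDatum L 3 (Matrix.of fun i j : Fin 3 => if i.val + j.val + 1 = 3 then (1 : L) else 0)).Adelic, (∃ g ∈ C, ConjClasses.mk g = c) →
      rep c ∈ C ∧ ConjClasses.mk (rep c) = c := by
    intro c h
    simp only [rep, dif_pos h]
    exact h.choose_spec
  -- a matching adèle behind `rep c` for `c ∈ 𝒞_𝐀` meeting `C`
  have hmatch : ∀ c : ConjClasses (UnitaryGroup.cmDatum L 3 (Matrix.of fun i j : Fin 3 => if i.val + j.val + 1 = 3 then (1 : L) else 0)).Adelic, c ∈ MatchingAdeleG.classes L H γ₀ →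
      (∃ g ∈ C, ConjClasses.mk g = c) → ∃ p : MatchingAdeleG L H γ₀, p.adele = rep c := by
    intro c hc h
    exact (MatchingAdeleG.mem_classes_iff_forall.1 hc).1 (rep c) (hrep c h).2
  -- (4) finitely many local classes at each place, and at `∞`, meet the image of `C`
  have hσ : ∀ v : HeightOneSpectrum (𝓞 ↥(maximalRealSubfield L)), ∀ x,
      UnitaryGroup.conjLocal L (IsCMField.complexConj L) v (UnitaryGroup.conjLocal L (IsCMField.complexConj L) v x) = x := fun v =>
    UnitaryGroup.conjLocal_conjLocal (IsCMField.complexConj L) v (complexConj_imagUnit L) (imagUnit_ne_zero L)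
  have hAv : ∀ v : HeightOneSpectrum (𝓞 ↥(maximalRealSubfield L)),
      (ConjClasses.mk '' {x : (UnitaryGroup.cmDatum L 3 (Matrix.of fun i j : Fin 3 => if i.val + j.val + 1 = 3 then (1 : L) else 0)).Local v |
        x ∈ (UnitaryGroup.cmDatum L 3 (Matrix.of fun i j : Fin 3 => if i.val + j.val + 1 = 3 then (1 : L) else 0)).toLocal v '' C ∧
          ∃ g : GL (Fin 3) (UnitaryGroup.LocalRing L v),
            g * (((UnitaryGroup.cmDatum L 3 (Matrix.of fun i j : Fin 3 => if i.val + j.val + 1 = 3 then (1 : L) else 0)).toLocal v ((UnitaryGroup.cmDatum L 3 (Matrix.of fun i j : Fin 3 => if i.val + j.val + 1 = 3 then (1 : L) else 0)).toAdelic γ)).val :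
              GL (Fin 3) (UnitaryGroup.LocalRing L v)) * g⁻¹ = x.val}).Finite := by
    intro v
    haveI := UnitaryGroup.locallyCompactSpace_localGL (E := L) 3 v
    haveI := UnitaryGroup.secondCountableTopology_localGL (E := L) 3 v
    exact finite_image_conjClassesMk_inter_stableClass (UnitaryGroup.conjLocal L (IsCMField.complexConj L) v)
      ((UnitaryGroup.adelicForm L 3 (Matrix.of fun i j : Fin 3 => if i.val + j.val + 1 = 3 then (1 : L) else 0)).map (UnitaryGroup.adeleToLocal L v))
      (UnitaryGroup.continuous_conjLocal L (IsCMField.complexConj L) v) (hσ v)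
      (UnitaryGroup.map_conjLocal_transpose_localForm L 3 (Matrix.of fun i j : Fin 3 => if i.val + j.val + 1 = 3 then (1 : L) else 0) v (UnitaryGroup.antidiagOne_isHermitian L 3))
      (UnitaryGroup.isUnit_det_localForm L 3 (Matrix.of fun i j : Fin 3 => if i.val + j.val + 1 = 3 then (1 : L) else 0) v (UnitaryGroup.isUnit_antidiagOne_det L 3).ne_zero)
      (UnitaryGroup.exists_isOpen_injOn_mul_self_localRing 3 v) _
      (UnitaryGroup.isClosed_conjClass_localGL_of_isRegularElt 3 v _ (hγv v))
      (hC.image ((UnitaryGroup.cmDatum L 3 (Matrix.of fun i j : Fin 3 => if i.val + j.val + 1 = 3 then (1 : L) else 0)).continuous_toLocal v))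
  have hAi : (ConjClasses.mk '' {x : UnitaryGroup.arch (↥(maximalRealSubfield L)) L (IsCMField.complexConj L) 3 (Matrix.of fun i j : Fin 3 => if i.val + j.val + 1 = 3 then (1 : L) else 0) |
      x ∈ UnitaryGroup.archPart (↥(maximalRealSubfield L)) L (IsCMField.complexConj L) 3 (Matrix.of fun i j : Fin 3 => if i.val + j.val + 1 = 3 then (1 : L) else 0) '' C ∧
        ∃ g : GL (Fin 3) (mixedEmbedding.mixedSpace L),
          g * ((cmRationalToArch L 3 (Matrix.of fun i j : Fin 3 => if i.val + j.val + 1 = 3 then (1 : L) else 0) γ).val : GL (Fin 3) (mixedEmbedding.mixedSpace L)) * g⁻¹ = x.val}).Finite := by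
    haveI : LocallyCompactSpace (GL (Fin 3) (mixedEmbedding.mixedSpace L)) := by
      haveI : LocallyCompactSpace (Matrix (Fin 3) (Fin 3) (mixedEmbedding.mixedSpace L)) :=
        inferInstanceAs (LocallyCompactSpace (Fin 3 → Fin 3 → mixedEmbedding.mixedSpace L))
      infer_instance
    haveI : SecondCountableTopology (GL (Fin 3) (mixedEmbedding.mixedSpace L)) := by
      haveI : SecondCountableTopology (Matrix (Fin 3) (Fin 3) (mixedEmbedding.mixedSpace L)) :=
        inferInstanceAs (SecondCountableTopology (Fin 3 → Fin 3 → mixedEmbedding.mixedSpace L))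
      haveI : SecondCountableTopology (Matrix (Fin 3) (Fin 3) (mixedEmbedding.mixedSpace L))ᵐᵒᵖ :=
        MulOpposite.opHomeomorph.symm.secondCountableTopology
      exact Units.isEmbedding_embedProduct.secondCountableTopology
    exact finite_image_conjClassesMk_inter_stableClass (UnitaryGroup.conjMixed (↥(maximalRealSubfield L)) L (IsCMField.complexConj L))
      (UnitaryGroup.archFormOf L 3 (Matrix.of fun i j : Fin 3 => if i.val + j.val + 1 = 3 then (1 : L) else 0)) (UnitaryGroup.continuous_conjMixed (↥(maximalRealSubfield L)) L (IsCMField.complexConj L))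
      (UnitaryGroup.conjMixed_conjMixed_of_apply_apply (↥(maximalRealSubfield L)) L (IsCMField.complexConj L)
        (IsCMField.complexConj_apply_apply L))
      (UnitaryGroup.map_conjMixed_transpose_archFormOf (↥(maximalRealSubfield L)) L (IsCMField.complexConj L) 3 (Matrix.of fun i j : Fin 3 => if i.val + j.val + 1 = 3 then (1 : L) else 0)
        (UnitaryGroup.antidiagOne_isHermitian L 3))
      (UnitaryGroup.isUnit_det_archFormOf L 3 (Matrix.of fun i j : Fin 3 => if i.val + j.val + 1 = 3 then (1 : L) else 0) (UnitaryGroup.isUnit_antidiagOne_det L 3).ne_zero)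
      (UnitaryGroup.exists_isOpen_injOn_mul_self_mixedSpace L 3) _
      (UnitaryGroup.isClosed_conjClass_mixedSpaceGL_of_isRegularElt L 3 _ hγi)
      (hC.image (UnitaryGroup.continuous_archPart (↥(maximalRealSubfield L)) L (IsCMField.complexConj L) 3 (Matrix.of fun i j : Fin 3 => if i.val + j.val + 1 = 3 then (1 : L) else 0)))
  -- (5) the map «class ↦ (local classes at T, archimedean class)», with finite target on our set
  let Ψ : ConjClasses (UnitaryGroup.cmDatum L 3 (Matrix.of fun i j : Fin 3 => if i.val + j.val + 1 = 3 then (1 : L) else 0)).Adelic →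
      ((v : ↥T) → ConjClasses ((UnitaryGroup.cmDatum L 3 (Matrix.of fun i j : Fin 3 => if i.val + j.val + 1 = 3 then (1 : L) else 0)).Local v.1)) ×
        ConjClasses (UnitaryGroup.arch (↥(maximalRealSubfield L)) L (IsCMField.complexConj L) 3 (Matrix.of fun i j : Fin 3 => if i.val + j.val + 1 = 3 then (1 : L) else 0)) := fun c =>
    (fun v => ConjClasses.mk ((UnitaryGroup.cmDatum L 3 (Matrix.of fun i j : Fin 3 => if i.val + j.val + 1 = 3 then (1 : L) else 0)).toLocal v.1 (rep c)),
      ConjClasses.mk (UnitaryGroup.archPart (↥(maximalRealSubfield L)) L (IsCMField.complexConj L) 3 (Matrix.of fun i j : Fin 3 => if i.val + j.val + 1 = 3 then (1 : L) else 0) (rep c)))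
  have hfinTarget : (Set.pi Set.univ (fun v : ↥T => ConjClasses.mk '' {x : (UnitaryGroup.cmDatum L 3 (Matrix.of fun i j : Fin 3 => if i.val + j.val + 1 = 3 then (1 : L) else 0)).Local v.1 |
        x ∈ (UnitaryGroup.cmDatum L 3 (Matrix.of fun i j : Fin 3 => if i.val + j.val + 1 = 3 then (1 : L) else 0)).toLocal v.1 '' C ∧
          ∃ g : GL (Fin 3) (UnitaryGroup.LocalRing L v.1),
            g * (((UnitaryGroup.cmDatum L 3 (Matrix.of fun i j : Fin 3 => if i.val + j.val + 1 = 3 then (1 : L) else 0)).toLocal v.1 ((UnitaryGroup.cmDatum L 3 (Matrix.of fun i j : Fin 3 => if i.val + j.val + 1 = 3 then (1 : L) else 0)).toAdelic γ)).val :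
              GL (Fin 3) (UnitaryGroup.LocalRing L v.1)) * g⁻¹ = x.val}) ×ˢ
      (ConjClasses.mk '' {x : UnitaryGroup.arch (↥(maximalRealSubfield L)) L (IsCMField.complexConj L) 3 (Matrix.of fun i j : Fin 3 => if i.val + j.val + 1 = 3 then (1 : L) else 0) |
        x ∈ UnitaryGroup.archPart (↥(maximalRealSubfield L)) L (IsCMField.complexConj L) 3 (Matrix.of fun i j : Fin 3 => if i.val + j.val + 1 = 3 then (1 : L) else 0) '' C ∧
          ∃ g : GL (Fin 3) (mixedEmbedding.mixedSpace L),
            g * ((cmRationalToArch L 3 (Matrix.of fun i j : Fin 3 => if i.val + j.val + 1 = 3 then (1 : L) else 0) γ).val : GL (Fin 3) (mixedEmbedding.mixedSpace L)) * g⁻¹ = x.val})).Finite :=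
    (Set.Finite.pi fun v => hAv v.1).prod hAi
  have hmaps : Set.MapsTo Ψ {c | c ∈ MatchingAdeleG.classes L H γ₀ ∧ ∃ g ∈ C, ConjClasses.mk g = c}
      (Set.pi Set.univ (fun v : ↥T => ConjClasses.mk '' {x : (UnitaryGroup.cmDatum L 3 (Matrix.of fun i j : Fin 3 => if i.val + j.val + 1 = 3 then (1 : L) else 0)).Local v.1 |
        x ∈ (UnitaryGroup.cmDatum L 3 (Matrix.of fun i j : Fin 3 => if i.val + j.val + 1 = 3 then (1 : L) else 0)).toLocal v.1 '' C ∧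
          ∃ g : GL (Fin 3) (UnitaryGroup.LocalRing L v.1),
            g * (((UnitaryGroup.cmDatum L 3 (Matrix.of fun i j : Fin 3 => if i.val + j.val + 1 = 3 then (1 : L) else 0)).toLocal v.1 ((UnitaryGroup.cmDatum L 3 (Matrix.of fun i j : Fin 3 => if i.val + j.val + 1 = 3 then (1 : L) else 0)).toAdelic γ)).val :
              GL (Fin 3) (UnitaryGroup.LocalRing L v.1)) * g⁻¹ = x.val}) ×ˢ
      (ConjClasses.mk '' {x : UnitaryGroup.arch (↥(maximalRealSubfield L)) L (IsCMField.complexConj L) 3 (Matrix.of fun i j : Fin 3 => if i.val + j.val + 1 = 3 then (1 : L) else 0) |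
        x ∈ UnitaryGroup.archPart (↥(maximalRealSubfield L)) L (IsCMField.complexConj L) 3 (Matrix.of fun i j : Fin 3 => if i.val + j.val + 1 = 3 then (1 : L) else 0) '' C ∧
          ∃ g : GL (Fin 3) (mixedEmbedding.mixedSpace L),
            g * ((cmRationalToArch L 3 (Matrix.of fun i j : Fin 3 => if i.val + j.val + 1 = 3 then (1 : L) else 0) γ).val : GL (Fin 3) (mixedEmbedding.mixedSpace L)) * g⁻¹ = x.val})) := by
    rintro c ⟨hc, hgC⟩
    obtain ⟨p, hp⟩ := hmatch c hc hgC
    have hrc := (hrep c hgC).1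
    refine Set.mk_mem_prod (Set.mem_univ_pi.2 fun v => ?_) ?_
    · refine ⟨(UnitaryGroup.cmDatum L 3 (Matrix.of fun i j : Fin 3 => if i.val + j.val + 1 = 3 then (1 : L) else 0)).toLocal v.1 (rep c), ⟨⟨rep c, hrc, rfl⟩, ?_⟩, rfl⟩
      have hst : IsStablyConj (UnitaryGroup.conjLocal L (IsCMField.complexConj L) v.1)
          ((UnitaryGroup.adelicForm L 3 (Matrix.of fun i j : Fin 3 => if i.val + j.val + 1 = 3 then (1 : L) else 0)).map (UnitaryGroup.adeleToLocal L v.1))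
          ((UnitaryGroup.cmDatum L 3 (Matrix.of fun i j : Fin 3 => if i.val + j.val + 1 = 3 then (1 : L) else 0)).toLocal v.1 ((UnitaryGroup.cmDatum L 3 (Matrix.of fun i j : Fin 3 => if i.val + j.val + 1 = 3 then (1 : L) else 0)).toAdelic γ))
          ((UnitaryGroup.cmDatum L 3 (Matrix.of fun i j : Fin 3 => if i.val + j.val + 1 = 3 then (1 : L) else 0)).toLocal v.1 (rep c)) := by
        have h2 := p.corresponds_toLocal v.1
        rw [hp] at h2
        exact (corresponds_toLocal_toAdelic hγ v.1).isStablyConj_right h2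
      exact isStablyConj_iff.1 hst
    · refine ⟨UnitaryGroup.archPart (↥(maximalRealSubfield L)) L (IsCMField.complexConj L) 3 (Matrix.of fun i j : Fin 3 => if i.val + j.val + 1 = 3 then (1 : L) else 0) (rep c), ⟨⟨rep c, hrc, rfl⟩, ?_⟩, rfl⟩
      have hst : IsStablyConj (UnitaryGroup.conjMixed (↥(maximalRealSubfield L)) L (IsCMField.complexConj L)) (UnitaryGroup.archFormOf L 3 (Matrix.of fun i j : Fin 3 => if i.val + j.val + 1 = 3 then (1 : L) else 0))
          (cmRationalToArch L 3 (Matrix.of fun i j : Fin 3 => if i.val + j.val + 1 = 3 then (1 : L) else 0) γ) (UnitaryGroup.archPart (↥(maximalRealSubfield L)) L (IsCMField.complexConj L) 3 (Matrix.of fun i j : Fin 3 => if i.val + j.val + 1 = 3 then (1 : L) else 0) (rep c)) := by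
        have h2 := p.corresponds_arch
        rw [MatchingAdeleG.arch, hp] at h2
        exact (corresponds_cmRationalToArch hγ).isStablyConj_right h2
      exact isStablyConj_iff.1 hst
  -- (6) injectivity on our set: the GLUING LEMMA
  have hinj : Set.InjOn Ψ {c | c ∈ MatchingAdeleG.classes L H γ₀ ∧ ∃ g ∈ C, ConjClasses.mk g = c} := by
    rintro c ⟨hc, hgC⟩ c' ⟨hc', hgC'⟩ heq
    obtain ⟨p, hp⟩ := hmatch c hc hgC
    obtain ⟨p', hp'⟩ := hmatch c' hc' hgC'
    have hrc := hrep c hgC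
    have hrc' := hrep c' hgC'
    -- at the good places both components are `K_v`-conjugate to `γ_v`
    have hgood : ∀ v ∉ T, ∃ k ∈ UnitaryGroup.cmLocalIntegralLevel L 3 (Matrix.of fun i j : Fin 3 => if i.val + j.val + 1 = 3 then (1 : L) else 0) v,
        k * (UnitaryGroup.cmDatum L 3 (Matrix.of fun i j : Fin 3 => if i.val + j.val + 1 = 3 then (1 : L) else 0)).toLocal v (rep c) * k⁻¹ = (UnitaryGroup.cmDatum L 3 (Matrix.of fun i j : Fin 3 => if i.val + j.val + 1 = 3 then (1 : L) else 0)).toLocal v (rep c') := by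
      intro v hv
      have h1 := p.corresponds_toLocal v
      rw [hp] at h1
      have h1' := p'.corresponds_toLocal v
      rw [hp'] at h1'
      obtain ⟨k, hk, hkeq⟩ := hTP v hv ((UnitaryGroup.cmDatum L 3 (Matrix.of fun i j : Fin 3 => if i.val + j.val + 1 = 3 then (1 : L) else 0)).toLocal v (rep c)) (hS _ hrc.1 v (hTS v hv)) h1
      obtain ⟨k', hk', hkeq'⟩ := hTP v hv ((UnitaryGroup.cmDatum L 3 (Matrix.of fun i j : Fin 3 => if i.val + j.val + 1 = 3 then (1 : L) else 0)).toLocal v (rep c')) (hS _ hrc'.1 v (hTS v hv)) h1'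
      refine ⟨k' * k⁻¹, mul_mem hk' (inv_mem hk), ?_⟩
      rw [← hkeq, ← hkeq', mul_inv_rev, inv_inv]
      group
    have hconj : IsConj (rep c) (rep c') := by
      refine UnitaryGroup.isConj_of_isConj_archPart_of_forall_exists_conj (↥(maximalRealSubfield L)) L (IsCMField.complexConj L) 3 (Matrix.of fun i j : Fin 3 => if i.val + j.val + 1 = 3 then (1 : L) else 0)
        ?_ (fun v => ?_) ?_
      · exact ConjClasses.mk_eq_mk_iff_isConj.1 (congrArg Prod.snd heq)
      · by_cases hvT : v ∈ T
        · exact ConjClasses.mk_eq_mk_iff_isConj.1 (congrFun (congrArg Prod.fst heq) ⟨v, hvT⟩)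
        · obtain ⟨k, -, hk⟩ := hgood v hvT
          exact isConj_iff.2 ⟨k, hk⟩
      · filter_upwards [T.finite_toSet.compl_mem_cofinite] with v hv
        obtain ⟨k, hk, hkeq⟩ := hgood v hv
        exact ⟨k, hk, hkeq⟩
    rw [← hrc.2, ← hrc'.2]
    exact ConjClasses.mk_eq_mk_iff_isConj.2 hconj
  exact Set.Finite.of_finite_image (hfinTarget.subset hmaps.image_subset) hinj

/-! ## §3 `Σ_{δ ∈ 𝒞_𝐀} Φ(δ, f)` is a finite sum for every `f ∈ C_c(U(Φ₃)(𝔸))` and every family of orbital measures -/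

/-- **The adelic stable orbital sum is finitely supported** — for EVERY family `m` of orbital measures on the classes of `U(Φ₃)(𝔸_L)` and EVERY `f`
with compact support (regular `γ₀` with rational correspondent `γ`, given the a.e. `K_v`-conjugacy of [Kt₄] Prop. 7.1 at `(γ₀, γ)` as a hypothesis;
see `MatchingAdeleG.finite_classes_inter_support_classOrbitalIntegral` for the named-fact form):
`(𝒞_𝐀(γ₀) ∩ support (c ↦ Φ_m(c, f))).Finite` — a class with `Φ_m(c, f) ≠ 0` meets `tsupport f` (★ `orbitalIntegral_eq_zero_of_forall_notMem_tsupport`),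
and only finitely many classes of `𝒞_𝐀` do (`finite_setOf_mem_classes_inter_of_eventually`). [cite: Rogawski1990, §4.3 p. 44; §5.4 p. 72] -/
theorem MatchingAdeleG.finite_classes_inter_support_classOrbitalIntegral_of_eventually
    {γ₀ : (UnitaryGroup.cmDatum L 3 H).Rational} (hreg : IsRegularElt (γ₀.val : GL (Fin 3) L))
    {γ : (UnitaryGroup.cmDatum L 3 (Matrix.of fun i j : Fin 3 => if i.val + j.val + 1 = 3 then (1 : L) else 0)).Rational} (hγ : Corresponds (cmConjRingHom L) H (Matrix.of fun i j : Fin 3 => if i.val + j.val + 1 = 3 then (1 : L) else 0) γ₀ γ)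
    (hP : ∀ᶠ v in cofinite, ∀ g : (UnitaryGroup.cmDatum L 3 (Matrix.of fun i j : Fin 3 => if i.val + j.val + 1 = 3 then (1 : L) else 0)).Local v,
      g ∈ UnitaryGroup.cmLocalIntegralLevel L 3 (Matrix.of fun i j : Fin 3 => if i.val + j.val + 1 = 3 then (1 : L) else 0) v →
        Corresponds (UnitaryGroup.conjLocal L (IsCMField.complexConj L) v)
            ((UnitaryGroup.adelicForm L 3 H).map (UnitaryGroup.adeleToLocal L v))
            ((UnitaryGroup.adelicForm L 3 (Matrix.of fun i j : Fin 3 => if i.val + j.val + 1 = 3 then (1 : L) else 0)).map (UnitaryGroup.adeleToLocal L v))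
            ((UnitaryGroup.cmDatum L 3 H).toLocal v ((UnitaryGroup.cmDatum L 3 H).toAdelic γ₀)) g →
          ∃ k ∈ UnitaryGroup.cmLocalIntegralLevel L 3 (Matrix.of fun i j : Fin 3 => if i.val + j.val + 1 = 3 then (1 : L) else 0) v,
            k * (UnitaryGroup.cmDatum L 3 (Matrix.of fun i j : Fin 3 => if i.val + j.val + 1 = 3 then (1 : L) else 0)).toLocal v ((UnitaryGroup.cmDatum L 3 (Matrix.of fun i j : Fin 3 => if i.val + j.val + 1 = 3 then (1 : L) else 0)).toAdelic γ) * k⁻¹ = g)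
    [∀ g : (UnitaryGroup.cmDatum L 3 (Matrix.of fun i j : Fin 3 => if i.val + j.val + 1 = 3 then (1 : L) else 0)).Adelic,
      MeasurableSpace ((UnitaryGroup.cmDatum L 3 (Matrix.of fun i j : Fin 3 => if i.val + j.val + 1 = 3 then (1 : L) else 0)).Adelic ⧸ Subgroup.centralizer ({g} : Set (UnitaryGroup.cmDatum L 3 (Matrix.of fun i j : Fin 3 => if i.val + j.val + 1 = 3 then (1 : L) else 0)).Adelic))]
    (m : OrbitalMeasureFamily (UnitaryGroup.cmDatum L 3 (Matrix.of fun i j : Fin 3 => if i.val + j.val + 1 = 3 then (1 : L) else 0)).Adelic) {E : Type*} [NormedAddCommGroup E] [NormedSpace ℝ E]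
    {f : (UnitaryGroup.cmDatum L 3 (Matrix.of fun i j : Fin 3 => if i.val + j.val + 1 = 3 then (1 : L) else 0)).Adelic → E} (hf : HasCompactSupport f) :
    (MatchingAdeleG.classes L H γ₀ ∩ Function.support (classOrbitalIntegral m f)).Finite := by
  refine (MatchingAdeleG.finite_setOf_mem_classes_inter_of_eventually hreg hγ hP hf.isCompact).subset ?_
  rintro c ⟨hc, hne⟩
  refine ⟨hc, ?_⟩
  by_contra hno
  refine hne ?_
  rw [classOrbitalIntegral_eq]
  refine orbitalIntegral_eq_zero_of_forall_notMem_tsupport _ _ fun g hg => hno ⟨g * Quotient.out c * g⁻¹, hg, ?_⟩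
  rw [← ConjClasses.mk_eq_mk_iff_isConj.2 (isConj_iff.2 ⟨g, rfl⟩), ← ConjClasses.quotient_mk_eq_mk, Quotient.out_eq]

end Finite

/-! ## §4 The named-fact forms (★ `MatchingAdeleGEventuallyKConj` = [Kt₄] Prop. 7.1, `K_v`-form) -/

section NamedFact

variable {L : Type} [Field L] [NumberField L] [IsCMField L] {H : Matrix (Fin 3) (Fin 3) L}

/-- **Only finitely many classes of `𝒞_𝐀(γ₀)` meet a compact set**, under ★ `MatchingAdeleGEventuallyKConj` (regular `γ₀`, rational correspondent `γ`).
[cite: Rogawski1990, §3.3 p. 21; §5.4 p. 72] [cite: Kottwitz1986, Prop. 7.1] -/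
theorem MatchingAdeleG.finite_setOf_mem_classes_inter (hKC : MatchingAdeleGEventuallyKConj L H)
    {γ₀ : (UnitaryGroup.cmDatum L 3 H).Rational} (hreg : IsRegularElt (γ₀.val : GL (Fin 3) L))
    {γ : (UnitaryGroup.cmDatum L 3 (Matrix.of fun i j : Fin 3 => if i.val + j.val + 1 = 3 then (1 : L) else 0)).Rational} (hγ : Corresponds (cmConjRingHom L) H (Matrix.of fun i j : Fin 3 => if i.val + j.val + 1 = 3 then (1 : L) else 0) γ₀ γ)
    {C : Set (UnitaryGroup.cmDatum L 3 (Matrix.of fun i j : Fin 3 => if i.val + j.val + 1 = 3 then (1 : L) else 0)).Adelic} (hC : IsCompact C) :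
    {c : ConjClasses (UnitaryGroup.cmDatum L 3 (Matrix.of fun i j : Fin 3 => if i.val + j.val + 1 = 3 then (1 : L) else 0)).Adelic |
      c ∈ MatchingAdeleG.classes L H γ₀ ∧ ∃ g ∈ C, ConjClasses.mk g = c}.Finite := by
  unfold MatchingAdeleGEventuallyKConj at hKC
  exact MatchingAdeleG.finite_setOf_mem_classes_inter_of_eventually hreg hγ (hKC γ₀ γ hreg hγ) hC

/-- **The adelic stable orbital sum `Σ_{δ ∈ 𝒞_𝐀(γ₀)} Φ_m(δ, f)` is finitely supported — every family `m`, every `f` with compact support**, under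
★ `MatchingAdeleGEventuallyKConj` (regular `γ₀`, rational correspondent `γ`): `(MatchingAdeleG.classes L H γ₀ ∩ support (classOrbitalIntegral m f)).Finite`.
«The sum is finite» [§4.3 p. 44] for the `finsum` defining the adelic stable orbital integral of the typer brick `AdelicStableOrbitalIntegral` — no Euler
hypothesis, no normalisation of `m`. [cite: Rogawski1990, §4.3 p. 44; §5.4 p. 72] [cite: Kottwitz1986, Prop. 7.1] -/
theorem MatchingAdeleG.finite_classes_inter_support_classOrbitalIntegral (hKC : MatchingAdeleGEventuallyKConj L H)
    {γ₀ : (UnitaryGroup.cmDatum L 3 H).Rational} (hreg : IsRegularElt (γ₀.val : GL (Fin 3) L))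
    {γ : (UnitaryGroup.cmDatum L 3 (Matrix.of fun i j : Fin 3 => if i.val + j.val + 1 = 3 then (1 : L) else 0)).Rational} (hγ : Corresponds (cmConjRingHom L) H (Matrix.of fun i j : Fin 3 => if i.val + j.val + 1 = 3 then (1 : L) else 0) γ₀ γ)
    [∀ g : (UnitaryGroup.cmDatum L 3 (Matrix.of fun i j : Fin 3 => if i.val + j.val + 1 = 3 then (1 : L) else 0)).Adelic,
      MeasurableSpace ((UnitaryGroup.cmDatum L 3 (Matrix.of fun i j : Fin 3 => if i.val + j.val + 1 = 3 then (1 : L) else 0)).Adelic ⧸ Subgroup.centralizer ({g} : Set (UnitaryGroup.cmDatum L 3 (Matrix.of fun i j : Fin 3 => if i.val + j.val + 1 = 3 then (1 : L) else 0)).Adelic))]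
    (m : OrbitalMeasureFamily (UnitaryGroup.cmDatum L 3 (Matrix.of fun i j : Fin 3 => if i.val + j.val + 1 = 3 then (1 : L) else 0)).Adelic) {E : Type*} [NormedAddCommGroup E] [NormedSpace ℝ E]
    {f : (UnitaryGroup.cmDatum L 3 (Matrix.of fun i j : Fin 3 => if i.val + j.val + 1 = 3 then (1 : L) else 0)).Adelic → E} (hf : HasCompactSupport f) :
    (MatchingAdeleG.classes L H γ₀ ∩ Function.support (classOrbitalIntegral m f)).Finite := by
  unfold MatchingAdeleGEventuallyKConj at hKC
  exact MatchingAdeleG.finite_classes_inter_support_classOrbitalIntegral_of_eventually hreg hγ (hKC γ₀ γ hreg hγ) m hf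

/-- The same for a test function `f ∈ C_c(U(Φ₃)(𝔸_L), E)`. [cite: Rogawski1990, §4.3 p. 44; §5.4 p. 72] -/
theorem MatchingAdeleG.finite_classes_inter_support_classOrbitalIntegral_cc (hKC : MatchingAdeleGEventuallyKConj L H)
    {γ₀ : (UnitaryGroup.cmDatum L 3 H).Rational} (hreg : IsRegularElt (γ₀.val : GL (Fin 3) L))
    {γ : (UnitaryGroup.cmDatum L 3 (Matrix.of fun i j : Fin 3 => if i.val + j.val + 1 = 3 then (1 : L) else 0)).Rational} (hγ : Corresponds (cmConjRingHom L) H (Matrix.of fun i j : Fin 3 => if i.val + j.val + 1 = 3 then (1 : L) else 0) γ₀ γ)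
    [∀ g : (UnitaryGroup.cmDatum L 3 (Matrix.of fun i j : Fin 3 => if i.val + j.val + 1 = 3 then (1 : L) else 0)).Adelic,
      MeasurableSpace ((UnitaryGroup.cmDatum L 3 (Matrix.of fun i j : Fin 3 => if i.val + j.val + 1 = 3 then (1 : L) else 0)).Adelic ⧸ Subgroup.centralizer ({g} : Set (UnitaryGroup.cmDatum L 3 (Matrix.of fun i j : Fin 3 => if i.val + j.val + 1 = 3 then (1 : L) else 0)).Adelic))]
    (m : OrbitalMeasureFamily (UnitaryGroup.cmDatum L 3 (Matrix.of fun i j : Fin 3 => if i.val + j.val + 1 = 3 then (1 : L) else 0)).Adelic) {E : Type*} [NormedAddCommGroup E] [NormedSpace ℝ E]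
    (f : CompactlySupportedContinuousMap (UnitaryGroup.cmDatum L 3 (Matrix.of fun i j : Fin 3 => if i.val + j.val + 1 = 3 then (1 : L) else 0)).Adelic E) :
    (MatchingAdeleG.classes L H γ₀ ∩ Function.support (classOrbitalIntegral m f)).Finite :=
  MatchingAdeleG.finite_classes_inter_support_classOrbitalIntegral hKC hreg hγ m f.hasCompactSupport

/-- **Unconditional in `γ`** (Kottwitz–Steinberg supplies the rational correspondent, ★ `exists_corresponds_antidiagThree_all`): for `H` non-degenerate hermitian,
every regular `γ₀ ∈ U(H)(L⁺)`, every family `m` and every `f` with compact support, `(𝒞_𝐀(γ₀) ∩ support Φ_m(·, f)).Finite`.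
[cite: Rogawski1990, §3.2 Thm. 3.2.1 p. 19; §4.3 p. 44] [cite: Kottwitz1986, Prop. 7.1] -/
theorem MatchingAdeleG.finite_classes_inter_support_classOrbitalIntegral_of_hermitian (hKC : MatchingAdeleGEventuallyKConj L H)
    (hH : conjTranspose L H = H) (h0 : H.det ≠ 0)
    {γ₀ : (UnitaryGroup.cmDatum L 3 H).Rational} (hreg : IsRegularElt (γ₀.val : GL (Fin 3) L))
    [∀ g : (UnitaryGroup.cmDatum L 3 (Matrix.of fun i j : Fin 3 => if i.val + j.val + 1 = 3 then (1 : L) else 0)).Adelic,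
      MeasurableSpace ((UnitaryGroup.cmDatum L 3 (Matrix.of fun i j : Fin 3 => if i.val + j.val + 1 = 3 then (1 : L) else 0)).Adelic ⧸ Subgroup.centralizer ({g} : Set (UnitaryGroup.cmDatum L 3 (Matrix.of fun i j : Fin 3 => if i.val + j.val + 1 = 3 then (1 : L) else 0)).Adelic))]
    (m : OrbitalMeasureFamily (UnitaryGroup.cmDatum L 3 (Matrix.of fun i j : Fin 3 => if i.val + j.val + 1 = 3 then (1 : L) else 0)).Adelic) {E : Type*} [NormedAddCommGroup E] [NormedSpace ℝ E]
    {f : (UnitaryGroup.cmDatum L 3 (Matrix.of fun i j : Fin 3 => if i.val + j.val + 1 = 3 then (1 : L) else 0)).Adelic → E} (hf : HasCompactSupport f) :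
    (MatchingAdeleG.classes L H γ₀ ∩ Function.support (classOrbitalIntegral m f)).Finite := by
  obtain ⟨γ, hγ⟩ := exists_corresponds_antidiagThree_all L H hH h0 γ₀
  exact MatchingAdeleG.finite_classes_inter_support_classOrbitalIntegral hKC hreg hγ m hf

end NamedFact


end Literature.NumberTheory.Rogawski1990
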